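import Summits.KontsevichZagierPeriods.KontsevichZagierPeriods.Theorems.OctahedralSymmetryOctahedralSpanAllWeightsStubWeightFourTableA
import Summits.KontsevichZagierPeriods.KontsevichZagierPeriods.Theorems.OctahedralSymmetryOctahedralSpanAllWeightsStubWeightFourTableB
import Summits.KontsevichZagierPeriods.KontsevichZagierPeriods.Theorems.OctahedralSymmetryOctahedralSpanAllWeightsStubWeightFourTableC
import Summits.KontsevichZagierPeriods.KontsevichZagierPeriods.Theorems.OctahedralSymmetryOctahedralSpanAllWeightsStubWeightFourTableD

/-!
# Crux `OctahedralSpanAllWeights` (stmt-KontsevichZagierPeriods-9659), line `Sketch`: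
# stub `StubWeightFour`

Registered stub `stub_weight_four : TwoLetterNormalForm 4`: each of the 400 convergent level-4
words of length 4 is, modulo the relation module `rel` (involution, distribution, finite double
shuffle, shuffle lifts), a `ℚ`-combination of the 16 words over the poles `±i`. The 384 words not
over `{1, 3}` are certified, with references to earlier-certified words, in the table parts
A, B, C, D (`…StubWeightFourTable*`, kernel reflection through `…StubWeightFourRefCert`); this file
discharges the parts' data hypotheses (the list of words a part assumes is contained in the list
certified by the parts before it — decided by the kernel), chains the parts, decides the coverage
of the 400 convergent words, and concludes by `twoLetterNormalForm_of_words`. Sizes: parts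
A/B/C/D hold 21/25/169/169 certificates with 38 965/37 257/18 920/3 010 expansion terms (4 213
generator terms in all; 356 certificates use a single generator, the 26 "fat" ones come from the
stuck phases of the peeling) and take about 180/200/175/80 s of kernel time on the farm.

Sources: J. Zhao, Doc. Math. 15 (2010), §2, §5; J. Zhao, C. R. Acad. Sci. Paris 346 (2008), §4;
P. Deligne, Publ. IHÉS 112 (2010) (`d(4,4) = 16`). Not here: weights `≥ 5`; independence of the
16 two-letter words modulo `rel`.
-/

namespace Summit.KontsevichZagierPeriods.OctahedralSymmetry.OctaSpan

open Literature.NumberTheory.Transcendental Literature.NumberTheory.Transcendental.LevelFour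

/-- The words of part A are certified (part A assumes nothing). [folklore] -/
theorem words4A : ∀ U ∈ E4A_13, sym U ∈ rel ⊔ twoSpan 4 :=
  table4A_certified (by simp [E4A_0])

/-- Data consistency: the words assumed by part B were certified by the parts before it
(kernel decision). [folklore] -/
theorem incl4B : ∀ U ∈ E4B_0, U ∈ E4A_13 := by
  decide +kernel

/-- The words of part B are certified. [folklore] -/
theorem words4B : ∀ U ∈ E4B_12, sym U ∈ rel ⊔ twoSpan 4 :=
  table4B_certified fun U hU => words4A U (incl4B U hU)

/-- Data consistency: the words assumed by part C were certified by the parts before it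
(kernel decision). [folklore] -/
theorem incl4C : ∀ U ∈ E4C_0, U ∈ E4B_12 := by
  decide +kernel

/-- The words of part C are certified. [folklore] -/
theorem words4C : ∀ U ∈ E4C_9, sym U ∈ rel ⊔ twoSpan 4 :=
  table4C_certified fun U hU => words4B U (incl4C U hU)

/-- Data consistency: the words assumed by part D were certified by the parts before it
(kernel decision). [folklore] -/
theorem incl4D : ∀ U ∈ E4D_0, U ∈ E4C_9 := by
  decide +kernel

/-- The words of part D are certified. [folklore] -/
theorem words4D : ∀ U ∈ E4D_5, sym U ∈ rel ⊔ twoSpan 4 :=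
  table4D_certified fun U hU => words4C U (incl4D U hU)

-- membership of the 384 certified words among the 625 words of length 4: above 200000 heartbeats
set_option maxHeartbeats 2000000 in
/-- Coverage: every convergent word of length 4 is over `{1, 3}` or certified. [folklore] -/
theorem cover4 : ∀ W ∈ allWords 4, IsConvergent W → (∀ a ∈ W, a = 1 ∨ a = 3) ∨ W ∈ E4D_5 := by
  decide +kernel

/-- **Calibration stub, weight 4**: the 400 convergent words of weight 4 reduce to the 16 words
over `±i` (384 kernel-checked certificates with references). [cite: Zhao2010, §2] -/
theorem stub_weight_four : TwoLetterNormalForm 4 := by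
  exact twoLetterNormalForm_of_words 4 E4D_5 words4D cover4

end Summit.KontsevichZagierPeriods.OctahedralSymmetry.OctaSpan
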